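import Summits.AnomalousDissipation.AnomalousDissipation.Theses.ClassTrim

/-!
# The ClassTrim junction: `PlanarStatesEject ⟺ T₁ ∧ T₂ ∧ P1″` and the two junction items

Sorry-free proofs, over the TREE decls, of
* `ClassTrim.PlanarStatesEjectTrim` (stmt-AnomalousDissipation-31418): `RelaxingPlanarDataEject → TameNonRelaxingDataEject →
  TurbulentNonRelaxingDataEject → SymmetricOrLoud.PlanarStatesEject` — case split on the datum: relaxing planar continuation (T₁) /
  non-relaxing in a TURBULENT class `n = 0 ∨ n = m ∨ n = −m` (P1″) / non-relaxing in a TAME class (T₂); thresholds `c₀ := min`, `ν₀ := min`;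
* `ClassTrim.ClassTrimJunctionGlue` (stmt-AnomalousDissipation-31417): the same followed by `EjectionPersists` (modus ponens) gives
  `SymmetricOrLoud.ThreeDFractionOrLoud` BY NAME (the junction recording that route ClassTrim refines SymmetricOrLoud:29278);
* the three kernel necessities (P1 ⇒ each piece) and hence the EXACTNESS `PlanarStatesEject ↔ T₁ ∧ T₂ ∧ P1″`.
Pure logic plus `c' ≤ c ⇒ c'·∫‖u‖² ≤ c·∫‖u‖²`; no facts asserted.
Source: decomp-ad cell, lens-4 g8 node «ClassTrim» (kernel `run/shared/lean/pub/decomp-ad/decomp-ad-lens-4/g8/ClassTrim.lean`, theorems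
`planarStatesEject_of_pieces` / `classTrimFamilyGlue_holds` / `planarStatesEject_iff_pieces` over Iff.rfl-identical named copies); re-keyed on the
raw tree texts and landed by the cell's prover seat.  Nothing here proves the summit.
-/

set_option linter.dupNamespace false

namespace Summit.AnomalousDissipation.AnomalousDissipation.Theorems.ClassTrimJunction

open scoped BigOperators Topology InnerProductSpace
open Filter MeasureTheory
open Summit.AnomalousDissipation.AnomalousDissipation.Theses
open Summit.AnomalousDissipation.AnomalousDissipation.Theses.ClassTrim

/-- T₁ ∧ T₂ ∧ P1″ ⇒ P1 (case split relaxing / turbulent non-relaxing / tame non-relaxing; `c₀ := min`, `ν₀ := min`). [folklore] -/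
theorem planarStatesEject_of_pieces (h₁ : RelaxingPlanarDataEject) (h₂ : TameNonRelaxingDataEject)
    (h₃ : TurbulentNonRelaxingDataEject) : SymmetricOrLoud.PlanarStatesEject := by
  obtain ⟨c₁, hc₁, ν₁, hν₁, H₁⟩ := h₁
  obtain ⟨c₂, hc₂, ν₂, hν₂, H₂⟩ := h₂
  obtain ⟨c₃, hc₃, ν₃, hν₃, H₃⟩ := h₃
  refine ⟨min c₁ (min c₂ c₃), lt_min hc₁ (lt_min hc₂ hc₃), min ν₁ (min ν₂ ν₃), lt_min hν₁ (lt_min hν₂ hν₃), ?_⟩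
  intro ν hν hνle p hp v₀ hex hmem hzero hpl hpos ε hε
  have hν₁' : ν ≤ ν₁ := hνle.trans (min_le_left _ _)
  have hν₂' : ν ≤ ν₂ := hνle.trans ((min_le_right _ _).trans (min_le_left _ _))
  have hν₃' : ν ≤ ν₃ := hνle.trans ((min_le_right _ _).trans (min_le_right _ _))
  by_cases hrel : ∃ v : ℝ → UnitAddTorus (Fin 3) → EuclideanSpace ℝ (Fin 3), Literature.Analysis.FluidPDE.Torus.IsGlobalLerayHopf ν (fun _ => ⇑(Literature.Analysis.FluidPDE.Torus.stokesMode (![0, 2, 0] : Fin 3 → ℤ) (EuclideanSpace.single (0 : Fin 3) (1 : ℝ)) false)) v₀ v ∧ (∀ t : ℝ, 0 ≤ t → ∀ (s : ℝ) (x : UnitAddTorus (Fin 3)), v t (x + Literature.Analysis.FluidPDE.toTorus (fun i => s * (![((p.1 : ℤ) : ℝ), 0, ((p.2 : ℤ) : ℝ)] : Fin 3 → ℝ) i)) = v t x) ∧ Filter.Tendsto (fun t : ℝ => ∫ x, ‖v t x - (16 * Real.pi ^ 2 * ν)⁻¹ • ⇑(Literature.Analysis.FluidPDE.Torus.stokesMode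 (![0, 2, 0] : Fin 3 → ℤ) (EuclideanSpace.single (0 : Fin 3) (1 : ℝ)) false) x‖ ^ 2) Filter.atTop (nhds 0)
  · obtain ⟨u₀, u, hLH, hmem', hclose, t, ht, hpos', hfrac⟩ := H₁ ν hν hν₁' p hp v₀ hrel hmem hzero hpl hpos ε hε
    exact ⟨u₀, u, hLH, hmem', hclose, t, ht, hpos',
      (mul_le_mul_of_nonneg_right (min_le_left _ _) (integral_nonneg fun _ => by positivity)).trans hfrac⟩
  · by_cases hcls : p.1 = 0 ∨ p.1 = p.2 ∨ p.1 = -p.2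
    · obtain ⟨u₀, u, hLH, hmem', hclose, t, ht, hpos', hfrac⟩ :=
        H₃ ν hν hν₃' p hp hcls v₀ hex hmem hzero hpl hpos hrel ε hε
      exact ⟨u₀, u, hLH, hmem', hclose, t, ht, hpos',
        (mul_le_mul_of_nonneg_right ((min_le_right _ _).trans (min_le_right _ _))
          (integral_nonneg fun _ => by positivity)).trans hfrac⟩
    · have hn0 : p.1 ≠ 0 := fun h => hcls (Or.inl h)
      have hnm : p.1 ≠ p.2 := fun h => hcls (Or.inr (Or.inl h))
      have hnm' : p.1 ≠ -p.2 := fun h => hcls (Or.inr (Or.inr h))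
      obtain ⟨u₀, u, hLH, hmem', hclose, t, ht, hpos', hfrac⟩ :=
        H₂ ν hν hν₂' p hn0 hnm hnm' v₀ hex hmem hzero hpl hpos hrel ε hε
      exact ⟨u₀, u, hLH, hmem', hclose, t, ht, hpos',
        (mul_le_mul_of_nonneg_right ((min_le_right _ _).trans (min_le_left _ _))
          (integral_nonneg fun _ => by positivity)).trans hfrac⟩

/-- P1 ⇒ T₁ (data with a relaxing planar continuation are a special case). [folklore] -/
theorem relaxingPlanarDataEject_of_planarStatesEject (h : SymmetricOrLoud.PlanarStatesEject) : RelaxingPlanarDataEject := by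
  obtain ⟨c₀, hc₀, ν₀, hν₀, H⟩ := h
  refine ⟨c₀, hc₀, ν₀, hν₀, fun ν hν hνle p hp v₀ hex hmem hzero hpl hpos ε hε => ?_⟩
  obtain ⟨v, hv, -, -⟩ := hex
  exact H ν hν hνle p hp v₀ ⟨v, hv⟩ hmem hzero hpl hpos ε hε

/-- P1 ⇒ T₂ (tame classes `n ≠ 0, n ≠ ±m`, non-relaxing data are a special case). [folklore] -/
theorem tameNonRelaxingDataEject_of_planarStatesEject (h : SymmetricOrLoud.PlanarStatesEject) : TameNonRelaxingDataEject := by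
  obtain ⟨c₀, hc₀, ν₀, hν₀, H⟩ := h
  refine ⟨c₀, hc₀, ν₀, hν₀, fun ν hν hνle p hn0 _ _ v₀ hex hmem hzero hpl hpos _ ε hε => ?_⟩
  exact H ν hν hνle p (fun h0 => hn0 (by rw [h0]; rfl)) v₀ hex hmem hzero hpl hpos ε hε

/-- P1 ⇒ P1″ (turbulent classes, non-relaxing data are a special case). [folklore] -/
theorem turbulentNonRelaxingDataEject_of_planarStatesEject (h : SymmetricOrLoud.PlanarStatesEject) :
    TurbulentNonRelaxingDataEject := by
  obtain ⟨c₀, hc₀, ν₀, hν₀, H⟩ := h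
  exact ⟨c₀, hc₀, ν₀, hν₀, fun ν hν hνle p hp _ v₀ hex hmem hzero hpl hpos _ ε hε =>
    H ν hν hνle p hp v₀ hex hmem hzero hpl hpos ε hε⟩

/-- EXACTNESS of the class trim: `PlanarStatesEject ⟺ T₁ ∧ T₂ ∧ P1″`. [folklore] -/
theorem planarStatesEject_iff_pieces : SymmetricOrLoud.PlanarStatesEject ↔
    (RelaxingPlanarDataEject ∧ TameNonRelaxingDataEject ∧ TurbulentNonRelaxingDataEject) :=
  ⟨fun h => ⟨relaxingPlanarDataEject_of_planarStatesEject h, tameNonRelaxingDataEject_of_planarStatesEject h,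
      turbulentNonRelaxingDataEject_of_planarStatesEject h⟩,
    fun h => planarStatesEject_of_pieces h.1 h.2.1 h.2.2⟩

/-- TRIM item 31418 `PlanarStatesEjectTrim` by name. [folklore] -/
theorem planarStatesEjectTrim_holds : PlanarStatesEjectTrim :=
  fun h₁ h₂ h₃ => planarStatesEject_iff_pieces.mpr ⟨h₁, h₂, h₃⟩

/-- JUNCTION item 31417 `ClassTrimJunctionGlue` by name: the four ClassTrim pieces compose to
`SymmetricOrLoud.ThreeDFractionOrLoud` (route ClassTrim refines SymmetricOrLoud:29278). [folklore] -/
theorem classTrimJunctionGlue_holds : ClassTrimJunctionGlue :=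
  fun h₁ h₂ h₃ hX => hX (planarStatesEject_of_pieces h₁ h₂ h₃)

end Summit.AnomalousDissipation.AnomalousDissipation.Theorems.ClassTrimJunction
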